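import Summits.QuantumAdvantage.QuantumAdvantage.Theorems.CubicForrelationNearExactIsExactQuadBalancedStructure

/-!
# Crux `CubicForrelation.NearExactIsExact` (stmt-QuantumAdvantage-14043), line `direct-sum-amplification`, lead c6:
  stub `stub_periodLemma` — an unbalanced `c`-periodic quadratic on 10 bits has a second period

In the `n = 10` window the derivative `δ = D_c g` of the cubic `g` along its split covector `c ≠ 0` is an UNBALANCED
quadratic with `δ(x ⊕ c) = δ(x)`.  This file shows that `δ` then has a period `r ∉ {0, c}` (so that `g` is affine on the
cosets of the plane `⟨c, r⟩`, the lead's bridge to the finite census).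

Elementary proof (no Dickson normal form).  Let `S := Σ_x (−1)^{δ(x)}` (an integer) and
`P := {a : ∀ x, δ(x ⊕ a) = δ(x)}` (the periods).
* `S² = Σ_a Σ_x (−1)^{δ(x) ⊕ δ(x ⊕ a)}` (`qb_sq_sum_signOf`, landed).
* Every derivative `D_a δ = δ ⊕ δ(· ⊕ a)` is affine (`stub_derivDegree`, landed), hence constant or balanced
  (`qb_affine_dichotomy`, landed).  Constant `true` is impossible: then `δ(x ⊕ a) = ¬δ(x)` and reindexing gives
  `S = −S`, i.e. `S = 0` (`pl_sum_eq_zero_of_compl`).  So the inner sum is `2ⁿ · [a ∈ P]` (`pl_inner_sum`) and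
  `S² = 2ⁿ · #P` (`pl_sq_eq`).
* `0, c ∈ P`; if these were the only periods then `#P = 2` and `S² = 2¹¹ = 2048`, which is not a square
  (`45² = 2025 < 2048 < 2116 = 46²`) although `S ∈ ℤ` (`pl_sum_signOf_int`) — contradiction.
(The parity of `n` matters: on `𝔽₂³`, `δ = x₀x₁` with `c = e₂` has no third period.)

Everything is proved from Mathlib and the tree (`qb_sq_sum_signOf`, `qb_affine_dichotomy`, `stub_derivDegree`,
`fc_bool_xor_eq_true`, `signOf_not`, the `bxor` algebra of `BuzetChailloux`); axioms are the standard three.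
Source for the ingredients: C. Carlet, *Boolean Functions for Cryptography and Coding Theory*, CUP 2021, §2.2
(derivatives, affine functions, autocorrelation / sum-of-squares indicator).
-/

set_option linter.dupNamespace false -- D-0017: single-problem summit ⇒ `QuantumAdvantage.QuantumAdvantage` by design

noncomputable section

namespace Summit.QuantumAdvantage.QuantumAdvantage.Theorems.CubicForrelation.NearExactIsExact

open Finset
open Literature.Computability.QuantumComplexity
open Literature.Computability.QuantumComplexity.BuzetChailloux (bxor zeroVec bxor_comm bxor_zeroVec bxorPerm
  bxorPerm_apply)
open Literature.Computability.QuantumComplexity.DerivativeWalsh (signOf_not)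

variable {n : ℕ}

/-! ### Complementing translates kill the bias -/

/-- If `δ(y ⊕ a) = ¬δ(y)` for every `y` then the bias `Σ_y (−1)^{δ(y)}` vanishes: reindexing the sum by the
involution `y ↦ y ⊕ a` negates it. [folklore] -/
theorem pl_sum_eq_zero_of_compl {δ : (Fin n → Bool) → Bool} {a : Fin n → Bool}
    (h : ∀ y, δ (bxor y a) = !δ y) : ∑ y, signOf (δ y) = 0 := by
  have hneg : ∑ y, signOf (δ y) = -∑ y, signOf (δ y) :=
    calc ∑ y, signOf (δ y) = ∑ y, signOf (δ (bxorPerm a y)) :=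
          (Equiv.sum_comp (bxorPerm a) (fun y => signOf (δ y))).symm
      _ = ∑ y, -signOf (δ y) := sum_congr rfl fun y _ => by
          rw [bxorPerm_apply, bxor_comm, h, signOf_not]
      _ = -∑ y, signOf (δ y) := sum_neg_distrib _
  linarith

/-! ### The derivative biases of an unbalanced quadratic -/

/-- **Inner sums.** For a quadratic `δ` with non-zero bias, the bias of the derivative `D_a δ` is `2ⁿ` if `a` is a
period of `δ` and `0` otherwise: `D_a δ` is affine (`stub_derivDegree`), hence constant or balanced
(`qb_affine_dichotomy`); constant `false` means `a` is a period, constant `true` would force the bias of `δ` to vanish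
(`pl_sum_eq_zero_of_compl`). [folklore] -/
theorem pl_inner_sum {δ : (Fin n → Bool) → Bool} (hδ : IsDegLeFun 2 δ) (hS : ∑ y, signOf (δ y) ≠ 0)
    (a : Fin n → Bool) :
    ∑ y, signOf (δ y ^^ δ (bxor y a)) = if (∀ y, δ (bxor y a) = δ y) then (2 : ℝ) ^ n else 0 := by
  split_ifs with ha
  · have h1 : ∀ y, signOf (δ y ^^ δ (bxor y a)) = 1 := fun y => by
      rw [ha y, Bool.xor_self]; rfl
    simp only [h1, sum_const, card_univ, Fintype.card_fun, Fintype.card_bool, Fintype.card_fin,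
      nsmul_eq_mul, mul_one, Nat.cast_pow, Nat.cast_ofNat]
  · rcases qb_affine_dichotomy (stub_derivDegree n 1 δ a hδ) with hc | hb
    · exfalso
      have hc : ∀ y, (δ y ^^ δ (bxor y a)) = (δ zeroVec ^^ δ (bxor zeroVec a)) := hc
      have key : ∀ u v : Bool, (u ^^ v) = false → v = u := by decide
      cases h0 : (δ zeroVec ^^ δ (bxor zeroVec a))
      · exact ha fun y => key _ _ ((hc y).trans h0)
      · exact hS (pl_sum_eq_zero_of_compl fun y => fc_bool_xor_eq_true _ _ ((hc y).trans h0))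
    · exact hb

/-- **Sum of squares indicator.** For a quadratic `δ` with non-zero bias `S`, `S² = 2ⁿ · #{a : a is a period of δ}`
(`qb_sq_sum_signOf` and `pl_inner_sum`). [folklore] -/
theorem pl_sq_eq {δ : (Fin n → Bool) → Bool} (hδ : IsDegLeFun 2 δ) (hS : ∑ y, signOf (δ y) ≠ 0) :
    (∑ y, signOf (δ y)) ^ 2 = (2 : ℝ) ^ n * ((univ.filter fun a => ∀ y, δ (bxor y a) = δ y).card : ℝ) := by
  rw [qb_sq_sum_signOf]
  simp_rw [pl_inner_sum hδ hS]
  rw [← sum_filter, sum_const, nsmul_eq_mul, mul_comm]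

/-- The bias `Σ_y (−1)^{δ(y)}` is an integer. [folklore] -/
theorem pl_sum_signOf_int (δ : (Fin n → Bool) → Bool) : ∃ k : ℤ, ∑ y, signOf (δ y) = (k : ℝ) :=
  ⟨∑ y, (if δ y then (-1 : ℤ) else 1), by
    push_cast
    exact sum_congr rfl fun y _ => by cases δ y <;> simp [signOf]⟩

/-- `2048 = 2¹¹` is not the square of an integer (`45² < 2048 < 46²`). [folklore] -/
theorem pl_sq_ne_2048 (k : ℤ) : k ^ 2 ≠ 2048 := by
  intro hk
  rcases le_total 0 k with h0 | h0
  · obtain h | h : k ≤ 45 ∨ 46 ≤ k := by omega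
    · nlinarith
    · nlinarith
  · obtain h | h : -45 ≤ k ∨ k ≤ -46 := by omega
    · nlinarith
    · nlinarith

/-! ### The stub -/

/-- **stub_periodLemma** (line `direct-sum-amplification`, `n = 10`).  An unbalanced quadratic
`δ : 𝔽₂¹⁰ → 𝔽₂` with a non-zero period `c` has a second period `r ∉ {0, c}`: with `S = Σ_x (−1)^{δ(x)} ∈ ℤ ∖ {0}`
and `P` the set of periods, `S² = 2¹⁰ · #P` (`pl_sq_eq`); `{0, c} ⊆ P`, and `P = {0, c}` would give `S² = 2048`,
not a square (`pl_sq_ne_2048`). [this line: lead c6] -/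
theorem stub_periodLemma : ∀ (δ : (Fin (4 + 4 + 1 + 1) → Bool) → Bool) (c : Fin (4 + 4 + 1 + 1) → Bool),
    IsDegLeFun 2 δ → c ≠ zeroVec → (∀ x, δ (bxor x c) = δ x) → (∑ x, signOf (δ x)) ≠ 0 →
      ∃ r : Fin (4 + 4 + 1 + 1) → Bool, r ≠ zeroVec ∧ r ≠ c ∧ ∀ x, δ (bxor x r) = δ x := by
  intro δ c hδ hc hper hS
  by_contra hne
  push Not at hne
  -- the periods are exactly `0` and `c`
  have hP : (univ.filter fun a => ∀ y, δ (bxor y a) = δ y) = {zeroVec, c} := by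
    ext a
    simp only [mem_filter, mem_univ, true_and, mem_insert, mem_singleton]
    constructor
    · intro ha
      by_contra h
      push Not at h
      obtain ⟨x, hx⟩ := hne a h.1 h.2
      exact hx (ha x)
    · rintro (rfl | rfl)
      · intro y
        rw [bxor_zeroVec]
      · exact hper
  have hsq := pl_sq_eq hδ hS
  rw [hP, card_pair (Ne.symm hc)] at hsq
  obtain ⟨k, hk⟩ := pl_sum_signOf_int δ
  rw [hk] at hsq
  have hk2 : ((k ^ 2 : ℤ) : ℝ) = ((2048 : ℤ) : ℝ) := by
    push_cast
    rw [hsq]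
    norm_num
  exact pl_sq_ne_2048 k (Int.cast_injective hk2)

end Summit.QuantumAdvantage.QuantumAdvantage.Theorems.CubicForrelation.NearExactIsExact
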